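import Summits.HodgeConjecture.HodgeConjecture.Theorems.Ring2HypothesesDescentMotivatedQuasiInverse
import Summits.HodgeConjecture.HodgeConjecture.Theorems.Ring2AbelianAllAndreFibreClassConstancyHolds
import HarnessLib

/-!
# Ring 2 hypotheses, descent face — MOTIVATED QUASI-INVERSES ON COMPACT ABELIAN PENCILS (unconditional), the β-rungs from
# «A_mot = A on the squares of the pencil total spaces», and the cell row `HC_CM ⟹ HC_AV` with X re-typed on the b05 axis

research route conditional on HC_CM; not a corollary; Q11.4-sentence-2 already refuted in dim ≥ 3.
Cell `pub-hodge-ring2` (Hodge ladder STAGE 3), seat `ring2-b05` (binder row b05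
`Ring2.Hypotheses.MotivatedImpliesAlgebraicAV`), gen 42; sequel of `…MotivatedQuasiInverse` (André Thm. 0.4 realised:
every motivated correspondence between two degrees of `H*(X(ℂ); ℂ)` has a motivated quasi-inverse, unconditionally).
`HC_CM` — BY NAME `Theses.RankFourFaces.CMAbelianHodge`, never restated — is a HYPOTHESIS in exactly one row (§2); no node
is discharged; the brackets «A_mot^d(𝒳 ⊗ 𝒳) ≤ A^d(𝒳 ⊗ 𝒳)» are hypotheses (instances of row b05's parent
`MotivatedImpliesAlgebraic`); the numbers «10 · 0» do not move.

* §0 `exists_motivated_idempotent_range_eq` / `exists_motivated_idempotent_ker_eq` — images and kernels of motivated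
  correspondences between two degrees are cut out by MOTIVATED IDEMPOTENTS (André Thm. 0.4: `𝓜` is abelian), unconditionally.
* §1 COMPACT ABELIAN PENCILS: `exists_motivated_quasiInverse_fiberGysin` — on EVERY compact pencil of abelian varieties the
  cup product with the fibre class `L_t = j_{t*} j_t^*` has a MOTIVATED quasi-inverse, UNCONDITIONALLY (ab-andre-2 part V
  docstring: the β-node «holds unconditionally with T MOTIVATED» — now a theorem); and the b05-axis β-rungs
  **`fibreClassLefschetzOn_of_motivatedClasses_sq_le`** — (β′_f) from «A_mot^d = A^d on `𝒳 ⊗ 𝒳`» (WEAKER input than the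
  sub-cell's `HC^d(𝒳 ⊗ 𝒳)` rung `fibreClassLefschetzOn_of_codim''`, motivated classes being Hodge classes; incomparable
  with `B(𝒳)`), node level `fibreClassLefschetzOnAtRelDim_of_motivatedClasses_sq_le`,
  `fibreClassLefschetzOnCompactPencils_of_motivatedClasses_sq_le`, and
  **`fibreClassLefschetzOnCompactPencils_of_motivatedImpliesAlgebraic`**: row b05's PARENT node gives (β∀′) directly.
* §2 THE CELL ROW WITH X RE-TYPED ON THE b05 AXIS: **`HC_CM ∧ [A_mot^d(𝒳 ⊗ 𝒳) = A^d(𝒳 ⊗ 𝒳) for the CM-pointed compact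
  pencils of abelian d-folds] ⟹ HC_AV` modulo Lemme 6.3.1 (c11)** (`hc_av_of_hc_cm_of_motivatedClasses_sq_le_of_andre1996`;
  `HC_CM` by name, load-bearing), the item's statement `CMToAbelian` from the same bracket, the KIND-1 form modulo
  {c11, c12}, and row b05 itself from its one-codimension restriction to the squares of the pencil total spaces.

No definition, no named fact, no sorry. References: Andre1996Motifs (Thm. 0.4 p. 7, §2.1 p. 14, Lemme 6.3.1 p. 31, §6.3
Remarque 2 p. 33), Abdulali1994FamiliesAV (Conj. 5.3, Rem. 5.4, Thm. 5.5, Lemma 6.2, pp. 1130–1131), Fulton1998 (§19.1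
Prop. 19.1.1), DeligneHodgeII1971 (Thm. 4.1.1 — consumed as the tree theorem (κ)).
-/

noncomputable section

-- every declaration of this problem lives in `Summit.HodgeConjecture.HodgeConjecture.…` (summit = sub-problem)
set_option linter.dupNamespace false

open CategoryTheory AlgebraicGeometry MonoidalCategory CartesianMonoidalCategory
open Literature.AlgebraicGeometry Literature.AlgebraicGeometry.Motives
  Literature.AlgebraicGeometry.HodgeTheory
open Summit.HodgeConjecture.HodgeConjecture.Ring2.AbelianAll

namespace Summit.HodgeConjecture.HodgeConjecture.Theorems

/-! ## §0 Images and kernels of motivated correspondences are cut out by MOTIVATED idempotents (André: `𝓜` is abelian) -/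

section Idempotents

variable {n : ℕ} {X : SchemeOver ℂ}

/-- **The image of a motivated correspondence `u : Hᵃ(X) → Hᵇ(X)` is the image of a MOTIVATED IDEMPOTENT of `Hᵇ(X)`**
(`p = u v` for a motivated quasi-inverse `v`: `p² = (u v u) v = p`, `Im p = Im u`) — unconditionally; André's Thm. 0.4
«`𝓜` est abélienne semi-simple»: images of morphisms are direct summands, realised on `H*(X(ℂ); ℂ)`.
[cite: Andre1996Motifs, Thm. 0.4 (p. 7) and §4] -/
theorem exists_motivated_idempotent_range_eq (hX : IsSmoothProjective n X) {a b e : ℕ} (ha : a ≤ 2 * n)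
    (hb : b ≤ 2 * n) (hab : a + 2 * e = b + 2 * n) {u : complexBetti X a →ₗ[ℂ] complexBetti X b}
    (hu : u ∈ (motivatedClasses (n + n) (X ⊗ X) e).map (corrAction complexOrientationFamily hX hX hab)) :
    ∃ p ∈ (motivatedClasses (n + n) (X ⊗ X) n).map (corrAction complexOrientationFamily hX hX (rfl : b + 2 * n = b + 2 * n)),
      p ∘ₗ p = p ∧ LinearMap.range p = LinearMap.range u := by
  obtain ⟨e', hba, v, hv, hvu⟩ := exists_motivated_quasiInverse hX ha hb hab hu
  refine ⟨u ∘ₗ v, comp_mem_map_corrAction_motivatedClasses complexOrientationFamily hX hX hX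
    (show e + e' = n + n by omega) hba hab rfl hu hv, ?_, ?_⟩
  · exact LinearMap.ext fun y ↦ by simp only [LinearMap.comp_apply, hvu]
  · refine le_antisymm (fun y ↦ ?_) (fun y ↦ ?_)
    · rintro ⟨z, rfl⟩
      exact ⟨v z, rfl⟩
    · rintro ⟨x, rfl⟩
      exact ⟨u x, by simp only [LinearMap.comp_apply, hvu]⟩

/-- **The kernel of a motivated correspondence `u : Hᵃ(X) → Hᵇ(X)` is the kernel of a MOTIVATED IDEMPOTENT of `Hᵃ(X)`**
(`q = v u`: `q² = v (u v u) = q`, `ker q = ker u`) — unconditionally. [cite: Andre1996Motifs, Thm. 0.4 (p. 7) and §4] -/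
theorem exists_motivated_idempotent_ker_eq (hX : IsSmoothProjective n X) {a b e : ℕ} (ha : a ≤ 2 * n)
    (hb : b ≤ 2 * n) (hab : a + 2 * e = b + 2 * n) {u : complexBetti X a →ₗ[ℂ] complexBetti X b}
    (hu : u ∈ (motivatedClasses (n + n) (X ⊗ X) e).map (corrAction complexOrientationFamily hX hX hab)) :
    ∃ q ∈ (motivatedClasses (n + n) (X ⊗ X) n).map (corrAction complexOrientationFamily hX hX (rfl : a + 2 * n = a + 2 * n)),
      q ∘ₗ q = q ∧ LinearMap.ker q = LinearMap.ker u := by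
  obtain ⟨e', hba, v, hv, hvu⟩ := exists_motivated_quasiInverse hX ha hb hab hu
  refine ⟨v ∘ₗ u, comp_mem_map_corrAction_motivatedClasses complexOrientationFamily hX hX hX
    (show e' + e = n + n by omega) hab hba rfl hv hu, ?_, ?_⟩
  · exact LinearMap.ext fun x ↦ by simp only [LinearMap.comp_apply, hvu]
  · ext x
    simp only [LinearMap.mem_ker, LinearMap.comp_apply]
    constructor
    · intro h
      rw [← hvu x, h, map_zero]
    · intro h
      rw [h, map_zero]

end Idempotents

/-! ## §1 Compact abelian pencils: motivated quasi-inverses of `L_t`, and the β-rungs from «A_mot = A» on the squares -/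

section Pencils

open Literature.AlgebraicTopology.SingularHomology (cupProduct)

variable {𝒳 S : SchemeOver ℂ} {d : ℕ} {f : 𝒳 ⟶ S}

/-- **On every compact pencil of abelian varieties, `L_t = j_{t*} j_t^*` (cup product with the fibre class) has a MOTIVATED
quasi-inverse in every degree `2p ≤ 2d`, UNCONDITIONALLY** (`L_t` is an algebraic correspondence of the `(d+1)`-fold `𝒳`,
ab-andre-1's `isAlgebraicCorrespondence_fiberGysin_comp_map`; then `exists_motivated_quasiInverse_of_isAlgebraicCorrespondence`).
The β-node (β′_f) asks for an ALGEBRAIC one. [cite: Andre1996Motifs, Thm. 0.4 (p. 7) and §6.3 Remarque 2 (p. 33)]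
[cite: Abdulali1994FamiliesAV, Conjecture 5.3 and Remark 5.4 (p. 1130)] -/
theorem exists_motivated_quasiInverse_fiberGysin (hf : IsCompactAbelianPencil f d) {p : ℕ} (hp : p ≤ d)
    (t : ComplexPoints S) :
    ∃ (e' : ℕ) (hba : 2 * (p + 1) + 2 * e' = 2 * p + 2 * (d + 1))
      (T : complexBetti 𝒳 (2 * (p + 1)) →ₗ[ℂ] complexBetti 𝒳 (2 * p)),
      T ∈ (motivatedClasses ((d + 1) + (d + 1)) (𝒳 ⊗ 𝒳) e').map
          (corrAction complexOrientationFamily hf.isSmoothProjective_total hf.isSmoothProjective_total hba) ∧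
        ∀ W : complexBetti 𝒳 (2 * p),
          fiberGysin hf t p (complexBetti.map (fiberι f t) (2 * p)
            (T (fiberGysin hf t p (complexBetti.map (fiberι f t) (2 * p) W)))) =
            fiberGysin hf t p (complexBetti.map (fiberι f t) (2 * p) W) := by
  obtain ⟨e', hba, T, hT, hTL⟩ := exists_motivated_quasiInverse_of_isAlgebraicCorrespondence hf.isSmoothProjective_total
    (show 2 * p ≤ 2 * (d + 1) by omega) (show 2 * (p + 1) ≤ 2 * (d + 1) by omega)
    (isAlgebraicCorrespondence_fiberGysin_comp_map hf t hp)
  exact ⟨e', hba, T, hT, fun W ↦ hTL W⟩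

/-- **(A_f) from «A_mot^d(𝒳 ⊗ 𝒳) = A^d(𝒳 ⊗ 𝒳)»**: if the motivated classes of codimension `d` on the square of the total
space of a compact pencil of abelian `d`-folds are algebraic, the cup product with the fibre class has ONE algebraic
quasi-inverse serving every fibre (the motivated quasi-inverse of §1 has codimension `d`; fibre-class constancy (φ), a
tree theorem, moves it between fibres; over an empty `S(ℂ)` the zero correspondence serves). NO `B(𝒳)`, no `HC`.
[cite: Andre1996Motifs, Thm. 0.4 (p. 7) and §6.3 Remarque 2 (p. 33)] [cite: Fulton1998, §19.1 proof of Prop. 19.1.1] -/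
theorem algebraicFibreClassQuasiInverseOn_of_motivatedClasses_sq_le (hf : IsCompactAbelianPencil f d)
    (hsq : motivatedClasses ((d + 1) + (d + 1)) (𝒳 ⊗ 𝒳) d ≤ algebraicClasses (𝒳 ⊗ 𝒳) d) :
    AlgebraicFibreClassQuasiInverseOn hf := by
  intro p hp
  have h𝒳 := hf.isSmoothProjective_total
  rcases isEmpty_or_nonempty (ComplexPoints S) with hS | ⟨⟨t₀⟩⟩
  · exact ⟨0, isAlgebraicCorrespondence_zero h𝒳 h𝒳 (e := d)
      (show 2 * (p + 1) + 2 * d = 2 * p + 2 * (d + 1) by omega) (by omega), fun t ↦ (IsEmpty.false t).elim⟩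
  · obtain ⟨T, hT, hTL⟩ := exists_algebraic_quasiInverse_of_motivatedClasses_sq_le h𝒳 (e := d + 2) (e' := d)
      (show 2 * p ≤ 2 * (d + 1) by omega) (show 2 * (p + 1) ≤ 2 * (d + 1) by omega) (by omega) (by omega) hsq
      (isAlgebraicCorrespondence_fiberGysin_comp_map hf t₀ hp)
    refine ⟨T, hT, fun t W ↦ ?_⟩
    rw [fiberGysin_map_fiberι_eq_of_const hf (fibreClassConstantCompactPencils_holds hf) t t₀ W,
      fiberGysin_map_fiberι_eq_of_const hf (fibreClassConstantCompactPencils_holds hf) t t₀]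
    exact hTL W

/-- **(β′_f) from «A_mot^d(𝒳 ⊗ 𝒳) = A^d(𝒳 ⊗ 𝒳)»** — the b05-axis β-rung per pencil: ab-andre-2's exact split
`(β′_f) ⟺ (κ_f) ∧ (A_f)` with (κ_f) a tree theorem and (A_f) from the preceding theorem. Compare the sub-cell's rung
`fibreClassLefschetzOn_of_codim''` (input: ALL rational `(d,d)`-classes of `𝒳 ⊗ 𝒳` algebraic — stronger, motivated classes
being Hodge classes) and `fibreClassLefschetzOn_of_lefschetzB` (input `B(𝒳)`). [cite: Andre1996Motifs, Thm. 0.4 (p. 7) and §2.1 (p. 14)]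
[cite: Abdulali1994FamiliesAV, Conjecture 5.3 and Theorem 5.5 (p. 1130)] -/
theorem fibreClassLefschetzOn_of_motivatedClasses_sq_le (hf : IsCompactAbelianPencil f d)
    (hsq : motivatedClasses ((d + 1) + (d + 1)) (𝒳 ⊗ 𝒳) d ≤ algebraicClasses (𝒳 ⊗ 𝒳) d) :
    FibreClassLefschetzOn hf :=
  fibreClassLefschetzOn_of_kernel_of_quasiInverse hf (fibreGysinKernelOn_holds hf)
    (algebraicFibreClassQuasiInverseOn_of_motivatedClasses_sq_le hf hsq)

/-- **Graded node: `(β′)_d` from «A_mot^d = A^d» on the squares of the total spaces of the CM-pointed compact pencils of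
abelian `d`-folds.** [cite: Andre1996Motifs, Thm. 0.4 (p. 7) and §6.3 Remarque 2 (p. 33)] -/
theorem fibreClassLefschetzOnAtRelDim_of_motivatedClasses_sq_le (d : ℕ)
    (hsq : ∀ ⦃𝒳 S : SchemeOver ℂ⦄ ⦃f : 𝒳 ⟶ S⦄, IsCompactAbelianPencil f d →
      motivatedClasses ((d + 1) + (d + 1)) (𝒳 ⊗ 𝒳) d ≤ algebraicClasses (𝒳 ⊗ 𝒳) d) :
    FibreClassLefschetzOnAtRelDim d :=
  fun _ _ _ hf _ ↦ fibreClassLefschetzOn_of_motivatedClasses_sq_le hf (hsq hf)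

/-- **(β∀′) from «A_mot^d = A^d» on the squares of all compact abelian pencil total spaces (every `d`).**
[cite: Andre1996Motifs, Thm. 0.4 (p. 7) and §6.3 Remarque 2 (p. 33)] -/
theorem fibreClassLefschetzOnCompactPencils_of_motivatedClasses_sq_le
    (hsq : ∀ ⦃d : ℕ⦄ ⦃𝒳 S : SchemeOver ℂ⦄ ⦃f : 𝒳 ⟶ S⦄, IsCompactAbelianPencil f d →
      motivatedClasses ((d + 1) + (d + 1)) (𝒳 ⊗ 𝒳) d ≤ algebraicClasses (𝒳 ⊗ 𝒳) d) :
    FibreClassLefschetzOnCompactPencils :=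
  fun _ _ _ _ hf ↦ fibreClassLefschetzOn_of_motivatedClasses_sq_le hf (hsq hf)

/-- **Row b05's PARENT node gives (β∀′) directly: `MotivatedImpliesAlgebraic ⟹ FibreClassLefschetzOnCompactPencils`** (one
codimension on the squares of the total spaces is all that is used) — WITHOUT passing through `B` or `HC_AV`.
[cite: Andre1996Motifs, Thm. 0.4 (p. 7), §2.1 (p. 14) and §6.3 Remarque 2 (p. 33)] -/
theorem fibreClassLefschetzOnCompactPencils_of_motivatedImpliesAlgebraic (h : Ring2.Hypotheses.MotivatedImpliesAlgebraic) :
    FibreClassLefschetzOnCompactPencils :=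
  fibreClassLefschetzOnCompactPencils_of_motivatedClasses_sq_le fun _ _ _ _ hf ↦
    h (hf.isSmoothProjective_total.tensor_holds hf.isSmoothProjective_total) _

end Pencils

/-! ## §2 The cell rows with X re-typed on the b05 axis: «A_mot = A in ONE codimension on the squares of the pencil total spaces» -/

section Rows

open Literature.AlgebraicGeometry.Deligne1982 (cmLocus)
open Literature.AlgebraicGeometry.Andre1996 (andre1996_cmAnchoredPencil
  andre1996_cmHodgeClasses_algebraicallyAnchoredPencils)

/-- **(β′) on the CM-pointed compact pencils from «A_mot^d = A^d» on the squares of their total spaces.**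
[cite: Andre1996Motifs, Thm. 0.4 (p. 7), Lemme 6.3.1 (p. 31) and §6.3 Remarque 2 (p. 33)] -/
theorem fibreClassLefschetzOnCMPointedPencils_of_motivatedClasses_sq_le
    (hsq : ∀ ⦃d : ℕ⦄ ⦃𝒳 S : SchemeOver ℂ⦄ ⦃f : 𝒳 ⟶ S⦄, IsCompactAbelianPencil f d → (cmLocus f d).Nonempty →
      motivatedClasses ((d + 1) + (d + 1)) (𝒳 ⊗ 𝒳) d ≤ algebraicClasses (𝒳 ⊗ 𝒳) d) :
    FibreClassLefschetzOnCMPointedPencils :=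
  fun _ _ _ _ hf hcm ↦ fibreClassLefschetzOn_of_motivatedClasses_sq_le hf (hsq hf hcm)

/-- **THE CELL ROW ON THE b05 AXIS WITH X RE-TYPED: `HC_CM ∧ [A_mot^d(𝒳 ⊗ 𝒳) = A^d(𝒳 ⊗ 𝒳) for every CM-pointed
compact pencil 𝒳 → S of abelian d-folds] ⟹ HC_AV`, modulo Lemme 6.3.1 (c11) alone.** The bracket is «motivated ⟹
algebraic» — row b05's own predicate — asked of ONE codimension on explicitly named smooth projective varieties (the
squares of the pencil total spaces), in place of the sub-cell's `B` for the total spaces (node (5)); neither implies the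
other in the kernel. `HC_CM` (`Theses.RankFourFaces.CMAbelianHodge`, BY NAME) is LOAD-BEARING; research route
conditional on HC_CM; not a corollary; Q11.4-sentence-2 already refuted in dim ≥ 3.
[cite: Andre1996Motifs, Thm. 0.4 (p. 7), Lemme 6.3.1 (p. 31) and §6.3 a) (p. 33)]
[cite: Abdulali1994FamiliesAV, Conjecture 5.3, Theorem 5.5 and Lemma 6.2 (pp. 1130–1131)] -/
theorem hc_av_of_hc_cm_of_motivatedClasses_sq_le_of_andre1996 (hCM : Theses.RankFourFaces.CMAbelianHodge)
    (h₂₁ : andre1996_cmAnchoredPencil)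
    (hsq : ∀ ⦃d : ℕ⦄ ⦃𝒳 S : SchemeOver ℂ⦄ ⦃f : 𝒳 ⟶ S⦄, IsCompactAbelianPencil f d → (cmLocus f d).Nonempty →
      motivatedClasses ((d + 1) + (d + 1)) (𝒳 ⊗ 𝒳) d ≤ algebraicClasses (𝒳 ⊗ 𝒳) d) :
    Theses.PadicSemiregularLift.HodgeAbelianVarieties :=
  HC_AV_of_HC_CM_and_fibreClassLefschetzOnCMPointedPencils h₂₁ hCM
    (fibreClassLefschetzOnCMPointedPencils_of_motivatedClasses_sq_le hsq)

/-- **The crux item `RankFourFaces.CMToAbelian` (stmt-HodgeConjecture-16267: `HC_CM → HC_AV`) from the same bracket,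
modulo Lemme 6.3.1** (the item stays OPEN: the bracket is a hypothesis). [cite: Andre1996Motifs, Lemme 6.3.1 (p. 31)] -/
theorem cmToAbelian_of_andre1996_of_motivatedClasses_sq_le (h₂₁ : andre1996_cmAnchoredPencil)
    (hsq : ∀ ⦃d : ℕ⦄ ⦃𝒳 S : SchemeOver ℂ⦄ ⦃f : 𝒳 ⟶ S⦄, IsCompactAbelianPencil f d → (cmLocus f d).Nonempty →
      motivatedClasses ((d + 1) + (d + 1)) (𝒳 ⊗ 𝒳) d ≤ algebraicClasses (𝒳 ⊗ 𝒳) d) :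
    Theses.RankFourFaces.CMToAbelian :=
  cmToAbelian_of_andre1996_of_fibreClassLefschetzOnCMPointedPencils h₂₁
    (fibreClassLefschetzOnCMPointedPencils_of_motivatedClasses_sq_le hsq)

/-- **KIND-1 (no `HC_CM`): «A_mot^d = A^d» on the squares of ALL compact abelian pencil total spaces ⟹ `HC_AV`**, modulo
Lemmes 6.3.1–6.3.3 (c11, c12). [cite: Andre1996Motifs, §6.3 Remarque 2 (p. 33)] -/
theorem hc_av_of_andre1996_of_motivatedClasses_sq_le (h₂₁ : andre1996_cmAnchoredPencil)
    (h₂₂ : andre1996_cmHodgeClasses_algebraicallyAnchoredPencils)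
    (hsq : ∀ ⦃d : ℕ⦄ ⦃𝒳 S : SchemeOver ℂ⦄ ⦃f : 𝒳 ⟶ S⦄, IsCompactAbelianPencil f d →
      motivatedClasses ((d + 1) + (d + 1)) (𝒳 ⊗ 𝒳) d ≤ algebraicClasses (𝒳 ⊗ 𝒳) d) :
    Theses.PadicSemiregularLift.HodgeAbelianVarieties :=
  HC_AV_of_andre1996_of_fibreClassLefschetzOnCompactPencils h₂₁ h₂₂
    (fibreClassLefschetzOnCompactPencils_of_motivatedClasses_sq_le hsq)

/-- **Row b05 itself from its restriction to ONE codimension on the squares of the compact abelian pencil total spaces**,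
modulo Lemmes 6.3.1–6.3.3: `[∀ pencils, A_mot^d(𝒳 ⊗ 𝒳) = A^d(𝒳 ⊗ 𝒳)] ⟹ MotivatedImpliesAlgebraicAV` (through `HC_AV` and the
discharged on-path lemma). Not a circularity: the squares `𝒳 ⊗ 𝒳` are not abelian varieties.
[cite: Andre1996Motifs, Thm. 0.6.2 (p. 9) and §6.3 Remarque 2 (p. 33)] -/
theorem motivatedImpliesAlgebraicAV_of_andre1996_of_motivatedClasses_sq_le (h₂₁ : andre1996_cmAnchoredPencil)
    (h₂₂ : andre1996_cmHodgeClasses_algebraicallyAnchoredPencils)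
    (hsq : ∀ ⦃d : ℕ⦄ ⦃𝒳 S : SchemeOver ℂ⦄ ⦃f : 𝒳 ⟶ S⦄, IsCompactAbelianPencil f d →
      motivatedClasses ((d + 1) + (d + 1)) (𝒳 ⊗ 𝒳) d ≤ algebraicClasses (𝒳 ⊗ 𝒳) d) :
    Ring2.Hypotheses.MotivatedImpliesAlgebraicAV :=
  Ring2.Hypotheses.motivatedImpliesAlgebraicAV_of_hc_av_holds (hc_av_of_andre1996_of_motivatedClasses_sq_le h₂₁ h₂₂ hsq)

end Rows

end Summit.HodgeConjecture.HodgeConjecture.Theorems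

end
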